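import Summits.QuantumFields.YangMills.Theorems.SoloBlindTwoPointRP
import HarnessLib

/-!
# Reflection positivity as a covariance inequality for ALL positive-time observables (solo-QuantumFields-blind, rung D7⁺)

The general real form of Osterwalder–Seiler positivity of Wilson's lattice gauge theory on the
even torus `(ℤ/L)^d`, `β ≥ 0`, compact structure group `G`, continuous matrix model `ρ`:

  `⟨ΘF⟩_{Λ,β} · ⟨F⟩_{Λ,β} ≤ ⟨ΘF · F⟩_{Λ,β}`      (`wilsonExpectation_timeReflect_mul_ge`)

for EVERY bounded measurable real observable `F` of the links in the positive-time half
`Λ₊ = {1 ≤ t ≤ L/2}` (`IsPositiveTimeObservable F`), where `(ΘF)(U) = F(ΘU)` is the reflected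
observable living in the negative half.  No gauge invariance, locality or reflection invariance of
`F` is needed.  In words: the connected correlation between any positive-time observable — a
Wilson loop of any shape, a product of plaquette energies, a smeared glueball operator — and its
mirror image is non-negative, at every coupling `β ≥ 0` and uniformly in the volume.  This is the
positivity half of the spectral (transfer-matrix) structure from which every infrared argument
about the time-direction two-point functions starts; rung D7
(`wilsonExpectation_plaquetteCost_sq_le_twoPoint`, single plaquette) is its simplest instance.

Proof: apply the tree's theorem `wilsonExpectation_reflectionPositive_holds` to the complexified
centred observable `U ↦ ((F U − ⟨F⟩ : ℝ) : ℂ)`, which is again bounded, measurable and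
positive-time, and expand.

References: K. Osterwalder, E. Seiler, Ann. Phys. 110 (1978) 440, §2; E. Seiler, LNP 159 (1982)
Ch. 2; J. Glimm, A. Jaffe, *Quantum Physics* (1987) §6.1. [folklore consequence of OS positivity;
the typed torus statement is this unit's]
-/

open MeasureTheory
open Literature.MathematicalPhysics.QuantumFieldTheory

noncomputable section

namespace Summit.QuantumFields.YangMills.Theorems.SoloBlind

variable {d L N : ℕ} [NeZero d] [NeZero L] {G : Type*} [Group G] [TopologicalSpace G]
  [IsTopologicalGroup G] [CompactSpace G] [MeasurableSpace G] [BorelSpace G]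
  (ρ : G →* Matrix (Fin N) (Fin N) ℂ)

omit [NeZero L] [Group G] [TopologicalSpace G] [IsTopologicalGroup G] [CompactSpace G] [MeasurableSpace G]
  [BorelSpace G] in
/-- A real positive-time observable shifted by a constant and complexified is positive-time.
[folklore] -/
theorem isPositiveTimeObservable_ofReal_sub {F : GaugeConfig d L G → ℝ}
    (hF : IsPositiveTimeObservable F) (c : ℝ) :
    IsPositiveTimeObservable (fun U : GaugeConfig d L G => ((F U - c : ℝ) : ℂ)) := by
  intro U V hUV
  simp only [hF U V hUV]

/-- Reflection positivity for the centred observable: `0 ≤ ⟨(ΘF − c)(F − c)⟩_{Λ,β}` for every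
bounded measurable real positive-time observable `F`, every constant `c`, `β ≥ 0`, `L` even.
[folklore] -/
theorem wilsonExpectation_centred_timeReflect_mul_nonneg (hL : Even L) (hρ : Continuous ρ)
    {β : ℝ} (hβ : 0 ≤ β) {F : GaugeConfig d L G → ℝ} (hFm : Measurable F)
    (hFb : ∃ C : ℝ, ∀ U, |F U| ≤ C) (hFpos : IsPositiveTimeObservable F) (c : ℝ) :
    0 ≤ wilsonExpectation ρ β fun U => (F U.timeReflect - c) * (F U - c) := by
  obtain ⟨C, hC⟩ := hFb
  set Fc : GaugeConfig d L G → ℂ := fun U => ((F U - c : ℝ) : ℂ) with hFc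
  have hFcm : Measurable Fc := Complex.measurable_ofReal.comp (hFm.sub_const c)
  have hFcb : ∃ C' : ℝ, ∀ U, ‖Fc U‖ ≤ C' := by
    refine ⟨C + |c|, fun U => ?_⟩
    rw [hFc]
    simp only [Complex.norm_real, Real.norm_eq_abs]
    calc |F U - c| ≤ |F U| + |c| := abs_sub _ _
      _ ≤ C + |c| := by gcongr; exact hC U
  have hRP := wilsonExpectation_reflectionPositive_holds (d := d) (L := L) ρ hL hρ hβ Fc hFcm hFcb
    (isPositiveTimeObservable_ofReal_sub hFpos c)
  have hint : (fun U : GaugeConfig d L G => (starRingEnd ℂ) (Fc U.timeReflect) * Fc U) =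
      fun U => (((F U.timeReflect - c) * (F U - c) : ℝ) : ℂ) := by
    funext U
    rw [hFc]
    simp only [Complex.conj_ofReal, Complex.ofReal_mul]
  rw [hint] at hRP
  unfold wilsonExpectation at hRP ⊢
  rw [integral_complex_ofReal] at hRP
  exact Complex.zero_le_real.mp hRP

/-- **Reflection positivity as a covariance inequality** (rung D7⁺).  For `β ≥ 0`, `L` even and
every bounded measurable real positive-time observable `F`:
`⟨ΘF⟩_{Λ,β} · ⟨F⟩_{Λ,β} ≤ ⟨ΘF · F⟩_{Λ,β}`. -/
theorem wilsonExpectation_timeReflect_mul_ge (hL : Even L) (hρ : Continuous ρ) {β : ℝ}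
    (hβ : 0 ≤ β) {F : GaugeConfig d L G → ℝ} (hFm : Measurable F)
    (hFb : ∃ C : ℝ, ∀ U, |F U| ≤ C) (hFpos : IsPositiveTimeObservable F) :
    wilsonExpectation ρ β (fun U => F U.timeReflect) * wilsonExpectation ρ β F ≤
      wilsonExpectation ρ β fun U => F U.timeReflect * F U := by
  haveI := isProbabilityMeasure_wilsonMeasure (d := d) (L := L) (G := G) ρ hρ β
  obtain ⟨C, hC⟩ := hFb
  set c := wilsonExpectation ρ β F with hc
  have h0 := wilsonExpectation_centred_timeReflect_mul_nonneg ρ hL hρ hβ hFm ⟨C, hC⟩ hFpos c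
  set A : GaugeConfig d L G → ℝ := fun U => F U.timeReflect with hA
  have hAm : Measurable A := hFm.comp WilsonRP.measurable_timeReflect
  have hAi : Integrable A (wilsonMeasure ρ β) :=
    Integrable.of_bound hAm.aestronglyMeasurable C
      (ae_of_all _ fun U => by rw [Real.norm_eq_abs]; exact hC _)
  have hFi : Integrable F (wilsonMeasure ρ β) :=
    Integrable.of_bound hFm.aestronglyMeasurable C
      (ae_of_all _ fun U => by rw [Real.norm_eq_abs]; exact hC _)
  have hAFi : Integrable (fun U => A U * F U) (wilsonMeasure ρ β) := by
    refine Integrable.of_bound (hAm.mul hFm).aestronglyMeasurable (C * C) (ae_of_all _ fun U => ?_)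
    rw [Real.norm_eq_abs, abs_mul]
    exact mul_le_mul (hC _) (hC _) (abs_nonneg _) ((abs_nonneg _).trans (hC U))
  have hexp : (fun U => (A U - c) * (F U - c)) = fun U => A U * F U - c * A U - c * F U + c ^ 2 := by
    funext U; ring
  have hE : wilsonExpectation ρ β (fun U => (A U - c) * (F U - c)) =
      wilsonExpectation ρ β (fun U => A U * F U) - c * wilsonExpectation ρ β A
        - c * wilsonExpectation ρ β F + c ^ 2 := by
    have i2 : Integrable (fun U => A U * F U - c * A U) (wilsonMeasure ρ β) := hAFi.sub (hAi.const_mul c)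
    have i3 : Integrable (fun U => A U * F U - c * A U - c * F U) (wilsonMeasure ρ β) :=
      i2.sub (hFi.const_mul c)
    unfold wilsonExpectation
    rw [hexp, integral_add i3 (integrable_const _), integral_sub i2 (hFi.const_mul c),
      integral_sub hAFi (hAi.const_mul c), integral_const_mul, integral_const_mul, integral_const]
    simp [Measure.real]
  have hEF : wilsonExpectation ρ β F = c := hc.symm
  rw [hE, hEF] at h0
  nlinarith [h0]

/-- Corollary: if moreover `⟨ΘF⟩ = ⟨F⟩` (e.g. by a symmetry of the torus state), the connected
correlation of `F` with its mirror image is non-negative: `⟨F⟩² ≤ ⟨ΘF · F⟩`. -/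
theorem wilsonExpectation_sq_le_timeReflect_mul (hL : Even L) (hρ : Continuous ρ) {β : ℝ}
    (hβ : 0 ≤ β) {F : GaugeConfig d L G → ℝ} (hFm : Measurable F)
    (hFb : ∃ C : ℝ, ∀ U, |F U| ≤ C) (hFpos : IsPositiveTimeObservable F)
    (hsymm : wilsonExpectation ρ β (fun U => F U.timeReflect) = wilsonExpectation ρ β F) :
    (wilsonExpectation ρ β F) ^ 2 ≤ wilsonExpectation ρ β fun U => F U.timeReflect * F U := by
  have h := wilsonExpectation_timeReflect_mul_ge ρ hL hρ hβ hFm hFb hFpos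
  rw [hsymm] at h
  nlinarith [h]

end Summit.QuantumFields.YangMills.Theorems.SoloBlind

end
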